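import Mathlib
import Summits.Ventures.PercRepro2.Defs
import Summits.Ventures.PercRepro2.Harris
import Summits.Ventures.PercRepro2.Graph
import Summits.Ventures.PercRepro2.Events
import Summits.Ventures.PercRepro2.Induced
import Summits.Ventures.PercRepro2.BHK
import Summits.Ventures.PercRepro2.BHKEvents
import Summits.Ventures.PercRepro2.VdBKahn
import Summits.Ventures.PercRepro2.BHKAvoid
import Summits.Ventures.PercRepro2.BHKMixed
import Summits.Ventures.PercRepro2.BHKAvoidWeighted

/-!
# BHK06 Theorem 1.5 (same-side instance) under set avoidance (PercRepro2, p2)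

`bhk_mixed_cluster` (BHKMixed.lean) under `Q = {s ↮ t}` says that for up-sets `𝓤, 𝓥` of the
cluster `C_s` and `𝓦` of `C_t`, the type-− events `{C_s ∈ 𝓤}` and `{C_s ∈ 𝓥, C_t ∉ 𝓦}` are
positively correlated.  This file is the same statement given `s ↮ X` for any `X ∋ t`
(`bhk_mixed_cluster_avoid`), by the functional inequality `bhk_induced` with the avoid sets
`X = Y` and the avoid-set bridge `E[1_𝓔(C_s)(1 − g_𝓦(C_s)) 1_{s↮X}] = P(C_s ∈ 𝓔, C_t ∉ 𝓦, s ↮ X)`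
(`expect_indicator_mul_one_sub_del_avoid`, from `prob_clusterIn_inter_avoid_eq_expect`).
Used by GenPlusContain.lean for the avoid set `{t, u}`.
-/

namespace Summit.Ventures.PercRepro2

section MixedAvoid

variable {V : Type*} {E : Type*} [Fintype E] [DecidableEq E] [Fintype V] [DecidableEq V]
  {R : Type*} [CommRing R] [LinearOrder R] [IsStrictOrderedRing R]

omit [DecidableEq V] [LinearOrder R] [IsStrictOrderedRing R] in
/-- `E[1_𝓔(C_s) · (1 − g_𝓦(C_s)) · 1_{s↮X}] = P(C_s ∈ 𝓔, C_t ∉ 𝓦, s ↮ X)` for `t ∈ X`,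
`g_𝓦 = delClusterProb` (the avoid-set version of `expect_indicator_mul_one_sub_del`). -/
lemma expect_indicator_mul_one_sub_del_avoid (p : E → R) (ends : E → Sym2 V) (s t : V)
    {X : Finset V} (ht : t ∈ X) (𝓔 𝓦 : Set (Set V)) :
    expect p (fun ω => 𝓔.indicator 1 (cluster ends ω s) *
        (1 - delClusterProb p ends t 𝓦 (cluster ends ω s)) * (avoidAll ends s X).indicator 1 ω) =
      prob p (clusterInEvent ends s 𝓔 ∩ (clusterInEvent ends t 𝓦)ᶜ ∩ avoidAll ends s X) := by
  have h1 : expect p (fun ω => 𝓔.indicator 1 (cluster ends ω s) * (avoidAll ends s X).indicator 1 ω) =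
      prob p (clusterInEvent ends s 𝓔 ∩ avoidAll ends s X) :=
    (prob_clusterInEvent_inter_eq_expect p ends s 𝓔 _).symm
  have h2 := prob_clusterIn_inter_avoid_eq_expect p ends s t ht 𝓔 𝓦
  have hsplit : prob p (clusterInEvent ends s 𝓔 ∩ clusterInEvent ends t 𝓦 ∩ avoidAll ends s X) +
      prob p (clusterInEvent ends s 𝓔 ∩ (clusterInEvent ends t 𝓦)ᶜ ∩ avoidAll ends s X) =
      prob p (clusterInEvent ends s 𝓔 ∩ avoidAll ends s X) := by
    rw [Set.inter_right_comm _ (clusterInEvent ends t 𝓦),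
      Set.inter_right_comm _ (clusterInEvent ends t 𝓦)ᶜ]
    exact prob_inter_add_prob_inter_compl p _ _
  have e : (fun ω => 𝓔.indicator 1 (cluster ends ω s) *
      (1 - delClusterProb p ends t 𝓦 (cluster ends ω s)) * (avoidAll ends s X).indicator 1 ω) =
      (fun ω => 𝓔.indicator 1 (cluster ends ω s) * (avoidAll ends s X).indicator 1 ω) -
        (fun ω => 𝓔.indicator 1 (cluster ends ω s) * delClusterProb p ends t 𝓦 (cluster ends ω s) *
          (avoidAll ends s X).indicator 1 ω) := by
    funext ω
    simp only [Pi.sub_apply]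
    ring
  rw [e, expect_sub, h1, ← h2]
  linear_combination -hsplit

/-- **BHK06 Theorem 1.5, same-side instance, under set avoidance** (`t ∈ X`): for up-sets `𝓤, 𝓥`
(events of `C_s`) and `𝓦` (event of `C_t`),
`P(C_s ∈ 𝓤, s↮X) · P(C_s ∈ 𝓥, C_t ∉ 𝓦, s↮X) ≤ P(C_s ∈ 𝓤 ∩ 𝓥, C_t ∉ 𝓦, s↮X) · P(s↮X)`:
the two type-− events are positively correlated given `s ↮ X`. -/
theorem bhk_mixed_cluster_avoid (p : E → R) (hp : IsProbVec p) (ends : E → Sym2 V) (s t : V)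
    {X : Finset V} (ht : t ∈ X) {𝓤 𝓥 𝓦 : Set (Set V)} (h𝓤 : IsUpperSet 𝓤) (h𝓥 : IsUpperSet 𝓥)
    (h𝓦 : IsUpperSet 𝓦) :
    prob p (clusterInEvent ends s 𝓤 ∩ avoidAll ends s X) *
        prob p (clusterInEvent ends s 𝓥 ∩ (clusterInEvent ends t 𝓦)ᶜ ∩ avoidAll ends s X) ≤
      prob p (clusterInEvent ends s (𝓤 ∩ 𝓥) ∩ (clusterInEvent ends t 𝓦)ᶜ ∩ avoidAll ends s X) *
        prob p (avoidAll ends s X) := by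
  classical
  set g := delClusterProb p ends t 𝓦 with hg
  have hg_anti : Antitone g := delClusterProb_anti p hp ends t h𝓦
  have hg1 : ∀ W, g W ≤ 1 := delClusterProb_le_one p hp ends t 𝓦
  have hF₁ : Monotone (𝓤.indicator (1 : Set V → R)) := monotone_indicator_one_of_isUpperSet h𝓤
  have hV : Monotone (𝓥.indicator (1 : Set V → R)) := monotone_indicator_one_of_isUpperSet h𝓥
  have hF₂ : Monotone (fun W => 𝓥.indicator (1 : Set V → R) W * (1 - g W)) := by
    intro W W' h
    simp only
    refine mul_le_mul (hV h) (by linarith [hg_anti h]) (by linarith [hg1 W])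
      (Set.indicator_apply_nonneg fun _ => zero_le_one)
  have hF₁0 : ∀ W, 0 ≤ 𝓤.indicator (1 : Set V → R) W :=
    fun W => Set.indicator_apply_nonneg fun _ => zero_le_one
  have hF₂0 : ∀ W, 0 ≤ 𝓥.indicator (1 : Set V → R) W * (1 - g W) := fun W =>
    mul_nonneg (Set.indicator_apply_nonneg fun _ => zero_le_one) (by linarith [hg1 W])
  have key := bhk_induced p hp ends s hF₁ hF₂ hF₁0 hF₂0 Finset.univ X X (Finset.subset_univ _)
    (Finset.subset_univ _)
  simp only [Finset.inter_self, Finset.union_self, REvent_univ] at key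
  have e : ∀ F : Set V → R, clusterObs ends Finset.univ s F * (avoidAll ends s X).indicator 1 =
      fun ω => F (cluster ends ω s) * (avoidAll ends s X).indicator 1 ω := by
    intro F
    funext ω
    simp only [Pi.mul_apply, clusterObs_apply, clusterIn_univ]
  rw [e, e, e] at key
  simp only [Pi.mul_apply] at key
  have eU : expect p (fun ω => 𝓤.indicator 1 (cluster ends ω s) *
      (avoidAll ends s X).indicator 1 ω) =
      prob p (clusterInEvent ends s 𝓤 ∩ avoidAll ends s X) :=
    (prob_clusterInEvent_inter_eq_expect p ends s 𝓤 _).symm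
  have e2 := expect_indicator_mul_one_sub_del_avoid p ends s t ht 𝓥 𝓦
  have e3 : expect p (fun ω => 𝓤.indicator 1 (cluster ends ω s) *
      (𝓥.indicator 1 (cluster ends ω s) * (1 - g (cluster ends ω s))) *
      (avoidAll ends s X).indicator 1 ω) =
      prob p (clusterInEvent ends s (𝓤 ∩ 𝓥) ∩ (clusterInEvent ends t 𝓦)ᶜ ∩ avoidAll ends s X) := by
    rw [← expect_indicator_mul_one_sub_del_avoid p ends s t ht (𝓤 ∩ 𝓥) 𝓦]
    congr 1
    funext ω
    rw [Set.inter_indicator_one, Pi.mul_apply]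
    ring
  rw [eU, e2, e3] at key
  exact key

end MixedAvoid

end Summit.Ventures.PercRepro2
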